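import Literature.AlgebraicGeometry.AbelianSchemes.RoofKernelIdealTorsion            -- ★ (ρ2″) p849822: roof currency, §1 bookkeeping, and its ★ imports (KER-EQ, descent, cancellations, duals)
import Literature.AlgebraicGeometry.AbelianSchemes.AbelianSchemeOverMulNFiniteFlat   -- ★ `[N]` surjective
import HarnessLib

/-!
# The TRANSLATE COMPOSITE `v := q ≫ d_p : A → A″` of a `p`-isogeny roof `A —q→ B ←c— A″`: an isogeny with kernel `A[𝔠·𝔮]` (`𝔭𝔮 = (p)`),
# `v^*λ″ = p²·λ`, `𝒪`-equivariant, `v(σᵢ) = σ″ᵢ^p` ([MumfordAV1970] §7 Thm. 4, §15 Thm. 1, §23; [Liu2021] Prop. D.8)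

Topic `AlgebraicGeometry/AbelianSchemes`, namespace `Literature.AlgebraicGeometry.AbelianSchemes.AbelianSchemeOver`.  THEOREMS ONLY (no definition, no named fact,
no `instance`, no notation, no `sorry`).  Cell `hodgecm-mathlib` (D-0151), F0∕P6 «MOD», line L2 (socket `stub_DOWN`), organ **(C5a)** «generic translate composite» of the
LS leaflet's §3a `exists_translReduction` (LA2-plan (g0) deal (ii) 2026-09-02T06:39:47Z, CURRENCY RULING (α) 06:49:55Z; skeleton + steps 0–3 LA2-p04 (g0),
rows KER∕FINITE∕SIM∕ACT∕LVL LA6-p03 (g2) after the re-deal 06:58:23Z): the UPSTAIRS half — everything ★ (ν8k)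
`exists_specialFibre_hom_reduction_ker_ringAction` asks of its input `u`, produced from the P6a letter `RoofΩ` (token shapes of ★ (ρ2″) `isIdealTorsion_mul_of_roof`).
`--supports stmt-HodgeConjecture-24832`, count-neutral.  HONEST LABEL: HC_CM is proved only modulo the cell's 2 remaining named inputs (hLiu418 24832, h413 24833)
until rung 0 closes; this file discharges none of them.

## Mathematics (pairing-free; `Ω = Ω̄` of characteristic `0`)

A ROOF `A —q→ B ←c— A″` of homomorphisms of abelian `Ω`-schemes with `𝒪`-actions (`𝒪 = 𝓞 F`): (r1) `Ker q(Ω) = A[𝔠](Ω)`, `q` surjective; (r2) `Ker c(Ω) = A″[𝔭](Ω)`,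
`c` surjective; (r3) `q^*λ_B = p·λ`, `c^*λ_B = p·λ″`; (r4) `q`, `c` equivariant for common `b_a ∈ End B`; (r5) `q(σᵢ) = c(σ″ᵢ)` for families of points `σ`, `σ″`; ideals
`𝔭, 𝔠 ≠ 0` and `𝔮` with `𝔭·𝔮 = (p)`.  (For the `⟨ϖ⟩`-translate roof of [Liu2021] Prop. D.8: `𝔠 = 𝔭_{c•w}`, `𝔭 = 𝔭_w`, `𝔮 = p𝔭_w⁻¹`.)
* `c` has kernel `A″[𝔭]` on ALL `T`-points (★ KER-EQ `comp_eq_one_iff_forall_mem_of_forall_points_of_charZero`), is finite (★ `isFinite_left_of_surjective_of_forall_points`)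
  and flat, so `[p]_{A″}` — which kills `Ker c ⊆ A″[p]` (`p ∈ 𝔭`) — DESCENDS: `c ≫ d = [p]` for a unique homomorphism `d : B → A″` (★ `existsUnique_comp_eq_of_forall_comp_eq_one`),
  and `d ≫ c = [p]_B`, `c^∨ ≫ d^∨ = [p]` (cancel `c`).
* `v := q ≫ d`.  KERNEL on `Ω`-points: `Ker d(Ω) = B[b(𝔮)]` (lift `b = c(a″)`: `d b = a″^p`, and `a″^p = 1 ⟺ ι″(𝔭𝔮) a″ = 1 ⟺ ι″(𝔮) a″ ⊆ Ker c ⟺ b(𝔮) b = 1`), hence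
  `Ker v(Ω) = q⁻¹ B[b(𝔮)] = {P | ι(𝔮)P ⊆ Ker q = A[𝔠]} = A[𝔠𝔮](Ω)`; on ALL `T`-points by ★ KER-EQ (Serre presentation of `𝔠𝔮 ≠ 0`, ★ `exists_serrePresentation_of_ideal`); `v` is
  surjective (`q` and `d` are) and finite (★, kernel killed by `ι(N)`, `0 ≠ N ∈ 𝔠𝔮`).
* SIMILITUDE: `c ≫ (d ≫ λ″ ≫ d^∨) ≫ c^∨ = [p] ≫ λ″ ≫ [p] = c ≫ (λ_B ≫ [p]) ≫ c^∨`, so `d ≫ λ″ ≫ d^∨ = λ_B ≫ [p]` (cancel `c` left — fppf —, `c^∨` right — `c^∨ ≫ d^∨ = [p]`,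
  ★ `cancel_right_of_comp_eq_pow_id`), whence `v ≫ λ″ ≫ v^∨ = q ≫ λ_B ≫ [p] ≫ q^∨ = λ ≫ [p²]`.
* EQUIVARIANCE: `c ≫ b_a ≫ d = ι″(a) ≫ [p] = [p] ≫ ι″(a) = c ≫ d ≫ ι″(a)`, so `b_a ≫ d = d ≫ ι″(a)` and `ι(a) ≫ v = v ≫ ι″(a)`.
* LEVEL: `v(σᵢ) = d(q σᵢ) = d(c σ″ᵢ) = σ″ᵢ^p`.

* `forall_mem_mul_of_forall_forall` (§1 bookkeeping: `ι(I)ι(J)` kills ⇒ `ι(IJ)` kills);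
* **`exists_translComposite_of_roof`** — THE HEAD (consumer-shaped: rows of `RoofΩ` in, rows of ★ (ν8k)'s input out).

## References
* [MumfordAV1970] D. Mumford, *Abelian Varieties* (1970), §7 Thm. 4 (p. 72), §15 Thm. 1 (p. 143), §23 (p. 231).
* [Liu2021] Y. Liu, *Fourier–Jacobi cycles and arithmetic relative trace formula*, Camb. J. Math. 9 (2021), App. D, Prop. D.8 (p. 135).
* [SerreTate1968] J.-P. Serre, J. Tate, *Good reduction of abelian varieties*, Ann. of Math. 88 (1968), §1 Lemma 2.
-/

set_option autoImplicit false

noncomputable section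

set_option backward.isDefEq.respectTransparency false

open CategoryTheory CategoryTheory.Limits AlgebraicGeometry MonoidalCategory CartesianMonoidalCategory
open scoped MonObj CategoryTheory.Obj NumberField Pointwise
open IsDedekindDomain NumberField
open Literature.AlgebraicGeometry.Motives (AlgPoints SchemeOver specOver)

namespace Literature.AlgebraicGeometry.AbelianSchemes

namespace AbelianSchemeOver

universe u

/-! ## §1 Bookkeeping: `ι(I)·ι(J)` kills `x` ⇒ `ι(I·J)` kills `x` -/

section Bookkeeping

variable {S : Scheme.{u}} {A : AbelianSchemeOver S} {O : Type*} [CommRing O] (act : A.RingAction O) {T : Over S}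

/-- If `(x ≫ ι u) ≫ ι b = 1` for all `u ∈ I`, `b ∈ J`, then `x ≫ ι m = 1` for all `m ∈ I * J` (products generate, `ι` additive).
[cite: MumfordAV1970, §19 Thm. 3 (p. 176)] -/
theorem forall_mem_mul_of_forall_forall (x : T ⟶ A.X) {I J : Ideal O} (h : ∀ u ∈ I, ∀ b ∈ J, (x ≫ act.i u) ≫ act.i b = 1) :
    ∀ m ∈ I * J, x ≫ act.i m = 1 := by
  intro m hm
  refine Submodule.mul_induction_on hm (fun u hu b hb => ?_) (fun a b ha hb => ?_)
  · rw [mul_comm, act.comp_i_mul]; exact h u hu b hb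
  · rw [act.comp_i_add, ha, hb, mul_one]

end Bookkeeping

/-! ## §2 The translate composite of a roof over `Ω = Ω̄` of characteristic `0` -/

section Roof

variable {F : Type} [Field F] [NumberField F]
  {Ω : Type} [Field Ω] [IsAlgClosed Ω] [CharZero Ω]
  {A A'' B : AbelianSchemeOver (Spec (.of Ω))}
  (act : A.RingAction (𝓞 F)) (act'' : A''.RingAction (𝓞 F))
  (D : A.DualPair) (pol : A.Polarization D) (D'' : A''.DualPair) (pol'' : A''.Polarization D'')
  (DB : B.DualPair) (lamB : B.X ⟶ DB.hat.X)
  (q : A.X ⟶ B.X) [IsMonHom q] (c : A''.X ⟶ B.X) [IsMonHom c]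

set_option maxHeartbeats 400000 in
/-- **THE TRANSLATE COMPOSITE OF A `p`-ISOGENY ROOF.**  Over `Ω = Ω̄` of characteristic `0`: abelian schemes `A, A″, B` with `𝓞 F`-actions on `A, A″`, polarisations `λ`,
`λ″`, a normalised dual pair on `B` with a homomorphism `λ_B`; a roof `A —q→ B ←c— A″` with `q` surjective, (r1) `Ker q(Ω) = A[𝔠](Ω)`, (r2) `Ker c(Ω) = A″[𝔭](Ω)` and `c`
surjective, (r3) `q^*λ_B = p·λ`, `c^*λ_B = p·λ″`, (r4) common equivariance, (r5) `q(σᵢ) = c(σ″ᵢ)`; ideals `𝔭, 𝔠 ≠ 0`, `𝔮` with `𝔭𝔮 = (p)`, `p ≠ 0`.  THEN there is a HOMOMORPHISM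
`v : A → A″` (the composite `q ≫ d`, `c ≫ d = [p]`), FINITE and SURJECTIVE, with KERNEL `A[𝔠𝔮]` on ALL `T`-points, `v^*λ″ = p²·λ` (★ `dualIsogenyOver`, ★ `mulN`),
`ι(a) ≫ v = v ≫ ι″(a)`, and `v(σᵢ) = σ″ᵢ^p` — the input rows of ★ (ν8k) `exists_specialFibre_hom_reduction_ker_ringAction` ((v′) `hker`, (iv), (ii-ι), (iii)).  The rows in are
the conjuncts of the P6a letter `RoofΩ` after `obtain`, in its token shapes (as ★ (ρ2″)); proof in the module docstring.
[cite: MumfordAV1970, §7 Thm. 4 (p. 72), §15 Thm. 1 (p. 143), §23 (p. 231)] [cite: Liu2021, Prop. D.8 (p. 135)] -/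
theorem exists_translComposite_of_roof
    -- the ideals: `Ker c = A″[𝔭]`, `Ker q = A[𝔠]`, and `𝔭·𝔮 = (p)`
    (𝔭 𝔠 𝔮 : Ideal (𝓞 F)) (h𝔭 : 𝔭 ≠ ⊥) (h𝔠 : 𝔠 ≠ ⊥) {p : ℕ} (hp : p ≠ 0) (hpq : 𝔭 * 𝔮 = Ideal.span {(p : 𝓞 F)})
    -- the normalisation of `B̂`'s Poincaré sheaf (the J12 pin of `RoofΩ`) and `q` surjective
    (hDB : Nonempty ((Scheme.Modules.pullback DB.unitHatSlice).obj DB.P ≅ SheafOfModules.unit _)) [Surjective q.left]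
    -- (r1) kernel of `q` on `Ω`-points = the `𝔠`-torsion
    (h1 : ∀ P : A.toAffine.toAbelianVariety.Points Ω,
      (AlgPoints.map q P : B.toAffine.toAbelianVariety.Points Ω) = 1 ↔
        ∀ a ∈ 𝔠, (AlgPoints.map (act.i a) P : A.toAffine.toAbelianVariety.Points Ω) = 1)
    -- (r2) kernel of `c` on `Ω`-points = the `𝔭`-torsion; `c` surjective
    (h2 : ∀ P : A''.toAffine.toAbelianVariety.Points Ω,
      (AlgPoints.map c P : B.toAffine.toAbelianVariety.Points Ω) = 1 ↔
        ∀ a ∈ 𝔭, (AlgPoints.map (act''.i a) P : A''.toAffine.toAbelianVariety.Points Ω) = 1)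
    (h2s : Function.Surjective c.left.base)
    -- (r3) polarisations: `q^* λ_B = p • λ`, `c^* λ_B = p • λ″`
    (h3 : q ≫ lamB ≫ DualPair.dualIsogenyOver q D DB = pol.lam ≫ D.hat.mulN p)
    (h3'' : c ≫ lamB ≫ DualPair.dualIsogenyOver c D'' DB = pol''.lam ≫ D''.hat.mulN p)
    -- (r4) `𝒪_F`-equivariance through a common endomorphism of `B`
    (h4 : ∀ a : 𝓞 F, ∃ b : B.X ⟶ B.X, act.i a ≫ q = q ≫ b ∧ act''.i a ≫ c = c ≫ b)
    -- (r5) families of points (the level points) corresponding under the roof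
    {J : Type} (σ : J → A.toAffine.toAbelianVariety.Points Ω) (σ'' : J → A''.toAffine.toAbelianVariety.Points Ω)
    (h5 : ∀ i, (AlgPoints.map q (σ i) : B.toAffine.toAbelianVariety.Points Ω) = AlgPoints.map c (σ'' i)) :
    ∃ (v : A.X ⟶ A''.X) (_ : IsMonHom v), IsFinite v.left ∧ Surjective v.left ∧
      -- kernel `A[𝔠𝔮]` on ALL `T`-points
      (∀ ⦃T : Over (Spec (.of Ω))⦄ (t : T ⟶ A.X), t ≫ v = 1 ↔ ∀ a ∈ 𝔠 * 𝔮, t ≫ act.i a = 1) ∧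
      -- similitude `v^* λ″ = p² • λ`
      v ≫ pol''.lam ≫ DualPair.dualIsogenyOver v D D'' = pol.lam ≫ D.hat.mulN (p * p) ∧
      -- equivariance
      (∀ a : 𝓞 F, act.i a ≫ v = v ≫ act''.i a) ∧
      -- points: `v(σᵢ) = σ″ᵢ ^ p`
      (∀ i, (AlgPoints.map v (σ i) : A''.toAffine.toAbelianVariety.Points Ω) = σ'' i ^ p) := by
  classical
  -- ===================== 0. INSTANCES =====================
  haveI : IsCommMonObj A.X := A.isCommMonObj_of_isReduced_base
  haveI : IsCommMonObj A''.X := A''.isCommMonObj_of_isReduced_base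
  haveI : IsCommMonObj B.X := B.isCommMonObj_of_isReduced_base
  haveI hpol := pol.isMonHom
  haveI hpol'' := pol''.isMonHom
  have hD := pol.nonempty_unitHatSlice_iso
  have hD'' := pol''.nonempty_unitHatSlice_iso
  haveI hqd : IsMonHom (DualPair.dualIsogenyOver q D DB) := DualPair.isMonHom_dualIsogenyOver q D DB hDB hD
  haveI hcd : IsMonHom (DualPair.dualIsogenyOver c D'' DB) := DualPair.isMonHom_dualIsogenyOver c D'' DB hDB hD''
  haveI : Surjective c.left := ⟨h2s⟩
  haveI : IsMonHom (A''.mulN p) := A''.isMonHom_mulN p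
  haveI : IsMonHom (A.mulN p) := A.isMonHom_mulN p
  haveI : IsMonHom (B.mulN p) := B.isMonHom_mulN p
  haveI : LocallyOfFiniteType A''.X.hom := (inferInstance : LocallyOfFiniteType A''.toAffine.toAbelianVariety.X.hom)
  have hp𝔭𝔮 : (p : 𝓞 F) ∈ 𝔭 * 𝔮 := hpq ▸ Ideal.mem_span_singleton_self _
  have hp𝔭 : (p : 𝓞 F) ∈ 𝔭 := Ideal.mul_le_right hp𝔭𝔮
  -- ===================== 1. THE LEG `c`: kernel `A″[𝔭]` on ALL `T`-points, finite, flat; the endomorphisms `b_a` =====================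
  obtain ⟨m, E, hE, Pm, Qm, N, hN, hP, hQ, hQP, hPQ, hspan, -, -⟩ :=
    Literature.NumberTheory.NumberFields.SerrePresentation.exists_serrePresentation_of_ideal 𝔭 h𝔭
  have hN𝔭 : ((N : ℕ) : 𝓞 F) ∈ 𝔭 := natCast_mem_of_quasiInverse Pm Qm hQP hspan
  have hkerc : ∀ ⦃T : Over (Spec (.of Ω))⦄ (t : T ⟶ A''.X), t ≫ c = 1 ↔ ∀ a ∈ 𝔭, t ≫ act''.i a = 1 :=
    fun T t => comp_eq_one_iff_forall_mem_of_forall_points_of_charZero act'' E hE Pm Qm c hN hP hQ hQP hPQ hspan h2 t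
  haveI hcfin : IsFinite c.left := isFinite_left_of_surjective_of_forall_points act'' c hN hN𝔭 (fun Pt hPt => (h2 Pt).1 hPt)
  haveI hcflat : Flat c.left := flat_left_of_isFinite_of_surjective c
  choose bB hbq hbc using h4
  -- ===================== 2. THE DESCENT `d : B → A″` OF `[p]_{A″}` THROUGH `c` =====================
  have hker_p : ∀ ⦃T : Over (Spec (.of Ω))⦄ (t : T ⟶ A''.X), t ≫ c = 1 → t ≫ A''.mulN p = 1 := fun T t ht => by
    have h := (hkerc t).1 ht (p : 𝓞 F) hp𝔭
    rw [comp_i_natCast] at h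
    rw [mulN_def, MonObj.comp_pow, Category.comp_id]
    exact h
  obtain ⟨d, hcd_p, -⟩ := A''.existsUnique_comp_eq_of_forall_comp_eq_one c (A''.mulN p) hker_p
  haveI hdmon : IsMonHom d := A''.isMonHom_of_comp_eq c (A''.mulN p) hcd_p
  have hdc_p : d ≫ c = B.mulN p := by
    apply A''.cancel_left_of_flat_surjective c
    rw [← Category.assoc, hcd_p, mulN_def, mulN_def]
    exact (A''.comp_pow_id_eq_pow_id_comp c p).symm
  have hcd_dual : DualPair.dualIsogenyOver c D'' DB ≫ DualPair.dualIsogenyOver d DB D'' = (𝟙 DB.hat.X) ^ p := by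
    rw [← DualPair.dualIsogenyOver_comp d c DB D'' DB, DualPair.dualIsogenyOver_congr DB DB (h₂ := B.isMonHom_mulN p) hdc_p,
      DB.dualIsogenyOver_mulN hDB p, mulN_def]
  haveI hdd : IsMonHom (DualPair.dualIsogenyOver d DB D'') := DualPair.isMonHom_dualIsogenyOver d DB D'' hD'' hDB
  -- `b_a ≫ d = d ≫ ι″(a)` (cancel the epimorphism `c`)
  have hbd : ∀ a : 𝓞 F, bB a ≫ d = d ≫ act''.i a := fun a => by
    haveI := act''.isMonHom a
    apply A''.cancel_left_of_flat_surjective c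
    rw [← Category.assoc, ← hbc, Category.assoc, hcd_p, ← Category.assoc, hcd_p, mulN_def]
    exact (A''.comp_pow_id_eq_pow_id_comp (act''.i a) p)
  -- ===================== 3. THE COMPOSITE `v := q ≫ d`: surjective (`q` and `d` are; `c ≫ d = [p]` is onto) =====================
  haveI : Surjective (A''.mulN p).left := A''.surjective_pow_id_left_of_ne_zero hp
  have hds : Function.Surjective d.left.base := by
    have h : Function.Surjective ((A''.mulN p).left).base := (inferInstance : Surjective (A''.mulN p).left).1
    rw [← hcd_p, Over.comp_left, Scheme.Hom.comp_base] at h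
    exact Function.Surjective.of_comp h
  haveI : Surjective d.left := ⟨hds⟩
  have hvs : Surjective (q ≫ d).left := by rw [Over.comp_left]; infer_instance
  haveI : Surjective (q ≫ d).left := hvs
  -- ===================== 4. KERNEL: `Ker (q ≫ d)(Ω) = A[𝔠𝔮](Ω)` by lifting along `c`, then on ALL `T`-points (★ KER-EQ) =====================
  have hq0 : 𝔮 ≠ ⊥ := by
    rintro rfl
    rw [Ideal.mul_bot] at hpq
    exact hp (by exact_mod_cast (Ideal.span_singleton_eq_bot.mp hpq.symm))
  have h𝔠𝔮 : 𝔠 * 𝔮 ≠ ⊥ := mul_ne_zero h𝔠 hq0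
  -- kernel of `q` on all `T`-points (★ KER-EQ from (r1))
  obtain ⟨m₁, E₁, hE₁, P₁, Q₁, N₁, hN₁, hP₁, hQ₁, hQP₁, hPQ₁, hspan₁, -, -⟩ :=
    Literature.NumberTheory.NumberFields.SerrePresentation.exists_serrePresentation_of_ideal 𝔠 h𝔠
  have hkerq : ∀ ⦃T : Over (Spec (.of Ω))⦄ (t : T ⟶ A.X), t ≫ q = 1 ↔ ∀ a ∈ 𝔠, t ≫ act.i a = 1 :=
    fun T t => comp_eq_one_iff_forall_mem_of_forall_points_of_charZero act E₁ hE₁ P₁ Q₁ q hN₁ hP₁ hQ₁ hQP₁ hPQ₁ hspan₁ h1 t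
  -- `c` is onto on `Ω`-points
  have hcΩ : Function.Surjective (AlgPoints.map (L := Ω) c) := AlgPoints.map_surjective_of_surjective_of_isAlgClosed' c
  -- the kernel of `v = q ≫ d` on `Ω`-points
  have hptsv : ∀ Pt : A.toAffine.toAbelianVariety.Points Ω,
      (AlgPoints.map (q ≫ d) Pt : A''.toAffine.toAbelianVariety.Points Ω) = 1 ↔
        ∀ a ∈ 𝔠 * 𝔮, (AlgPoints.map (act.i a) Pt : A.toAffine.toAbelianVariety.Points Ω) = 1 := by
    intro Pt
    obtain ⟨a'', ha''⟩ := hcΩ (AlgPoints.map q Pt)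
    rw [AlgPoints.map_apply, AlgPoints.map_apply] at ha''
    -- `Pt ≫ q ≫ d = a″ ≫ c ≫ d = a″ ≫ ι″(p)`
    have hvPt : (Pt ≫ q ≫ d : specOver Ω Ω ⟶ A''.X) = a'' ≫ act''.i (p : 𝓞 F) := by
      rw [← Category.assoc, ← ha'', Category.assoc, hcd_p, comp_i_natCast, mulN_def, MonObj.comp_pow, Category.comp_id]
    -- `(a″ ≫ ι″ u) ≫ c = (Pt ≫ ι u) ≫ q`
    have hZ : ∀ u : 𝓞 F, (a'' ≫ act''.i u) ≫ c = (Pt ≫ act.i u) ≫ q := fun u => by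
      rw [Category.assoc, hbc u, ← Category.assoc, ha'', Category.assoc, ← hbq u, Category.assoc]
    show (Pt ≫ q ≫ d = 1) ↔ ∀ a ∈ 𝔠 * 𝔮, Pt ≫ act.i a = 1
    rw [hvPt]
    constructor
    · intro hx
      -- `a″` killed by `(p) = 𝔭𝔮`
      have hx' : ∀ mm ∈ 𝔭 * 𝔮, a'' ≫ act''.i mm = 1 := by
        rw [hpq]
        refine forall_mem_span_natCast_of_pow_eq_one act'' a'' ?_
        rw [← comp_i_natCast act'' a'' p]; exact hx
      -- for `u ∈ 𝔮`: `(a″ ≫ ι″ u) ≫ c = 1`, i.e. `(Pt ≫ ι u) ≫ q = 1`, i.e. `Pt ≫ ι u` is `𝔠`-torsion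
      have hu : ∀ u ∈ 𝔮, ∀ a ∈ 𝔠, (Pt ≫ act.i u) ≫ act.i a = 1 := fun u hu => by
        have h := forall_mem_comp_i_comp_i_eq_one act'' a'' hx' (I := 𝔮) (J := 𝔭) (by rw [mul_comm]) hu
        rw [← hkerc, hZ u, hkerq] at h
        exact h
      have h := forall_mem_mul_of_forall_forall act Pt hu
      rwa [mul_comm] at h
    · intro hx
      have hu : ∀ u ∈ 𝔮, ∀ b ∈ 𝔭, (a'' ≫ act''.i u) ≫ act''.i b = 1 := fun u hu => by
        rw [← hkerc, hZ u, hkerq]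
        exact forall_mem_comp_i_comp_i_eq_one act Pt hx (I := 𝔮) (J := 𝔠) (by rw [mul_comm]) hu
      have h := forall_mem_mul_of_forall_forall act'' a'' hu
      rw [mul_comm, hpq] at h
      have hp1 := h (p : 𝓞 F) (Ideal.mem_span_singleton_self _)
      exact hp1
  -- on ALL `T`-points (★ KER-EQ with a Serre presentation of `𝔠𝔮`)
  obtain ⟨m₂, E₂, hE₂, P₂, Q₂, N₂, hN₂, hP₂, hQ₂, hQP₂, hPQ₂, hspan₂, -, -⟩ :=
    Literature.NumberTheory.NumberFields.SerrePresentation.exists_serrePresentation_of_ideal (𝔠 * 𝔮) h𝔠𝔮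
  have hN₂mem : ((N₂ : ℕ) : 𝓞 F) ∈ 𝔠 * 𝔮 := natCast_mem_of_quasiInverse P₂ Q₂ hQP₂ hspan₂
  have hkerv : ∀ ⦃T : Over (Spec (.of Ω))⦄ (t : T ⟶ A.X), t ≫ (q ≫ d) = 1 ↔ ∀ a ∈ 𝔠 * 𝔮, t ≫ act.i a = 1 :=
    fun T t => comp_eq_one_iff_forall_mem_of_forall_points_of_charZero act E₂ hE₂ P₂ Q₂ (q ≫ d) hN₂ hP₂ hQ₂ hQP₂ hPQ₂ hspan₂ hptsv t
  refine ⟨q ≫ d, inferInstance, ?_, hvs, hkerv, ?_, ?_, ?_⟩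
  -- ===================== 5. FINITE =====================
  · exact isFinite_left_of_surjective_of_forall_points act (q ≫ d) hN₂ hN₂mem (fun Pt hPt => (hptsv Pt).1 hPt)
  -- ===================== 6. SIMILITUDE `v^*λ″ = p²·λ` =====================
  · -- `d ≫ λ″ ≫ d^∨ = λ_B ≫ [p]` (cancel the fppf `c` on the left; `c^∨ ≫ d^∨ = [p]`)
    have hlam'' : A''.mulN p ≫ pol''.lam = pol''.lam ≫ D''.hat.mulN p := by
      rw [mulN_def, mulN_def]; exact (A''.comp_pow_id_eq_pow_id_comp pol''.lam p).symm
    have key : d ≫ pol''.lam ≫ DualPair.dualIsogenyOver d DB D'' = lamB ≫ DB.hat.mulN p := by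
      apply A''.cancel_left_of_flat_surjective c
      calc c ≫ d ≫ pol''.lam ≫ DualPair.dualIsogenyOver d DB D''
          = (c ≫ d) ≫ pol''.lam ≫ DualPair.dualIsogenyOver d DB D'' := by rw [Category.assoc]
        _ = (pol''.lam ≫ D''.hat.mulN p) ≫ DualPair.dualIsogenyOver d DB D'' := by rw [hcd_p, ← Category.assoc, hlam'']
        _ = (c ≫ lamB ≫ DualPair.dualIsogenyOver c D'' DB) ≫ DualPair.dualIsogenyOver d DB D'' := by rw [h3'']
        _ = c ≫ lamB ≫ DB.hat.mulN p := by
            simp only [Category.assoc]; rw [hcd_dual, mulN_def]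
    rw [DualPair.dualIsogenyOver_comp q d D DB D'']
    calc (q ≫ d) ≫ pol''.lam ≫ DualPair.dualIsogenyOver d DB D'' ≫ DualPair.dualIsogenyOver q D DB
        = q ≫ (d ≫ pol''.lam ≫ DualPair.dualIsogenyOver d DB D'') ≫ DualPair.dualIsogenyOver q D DB := by simp only [Category.assoc]
      _ = q ≫ lamB ≫ (DB.hat.mulN p ≫ DualPair.dualIsogenyOver q D DB) := by rw [key]; simp only [Category.assoc]
      _ = q ≫ lamB ≫ (DualPair.dualIsogenyOver q D DB ≫ D.hat.mulN p) := by
          rw [mulN_def, mulN_def, ← DB.hat.comp_pow_id_eq_pow_id_comp (DualPair.dualIsogenyOver q D DB) p]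
      _ = (q ≫ lamB ≫ DualPair.dualIsogenyOver q D DB) ≫ D.hat.mulN p := by simp only [Category.assoc]
      _ = pol.lam ≫ D.hat.mulN (p * p) := by
          rw [h3, Category.assoc, mulN_def, mulN_def, MonObj.comp_pow, Category.comp_id, ← pow_mul]
  -- ===================== 7. EQUIVARIANCE =====================
  · intro a
    rw [← Category.assoc, hbq a, Category.assoc, hbd a, Category.assoc]
  -- ===================== 8. POINTS `v(σᵢ) = σ″ᵢ^p` =====================
  · intro i
    have h := h5 i
    rw [AlgPoints.map_apply, AlgPoints.map_apply] at h
    rw [AlgPoints.map_apply, ← Category.assoc, h, Category.assoc, hcd_p, mulN_def, MonObj.comp_pow, Category.comp_id]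

end Roof

end AbelianSchemeOver

end Literature.AlgebraicGeometry.AbelianSchemes

end
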